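import Summits.Ventures.LatticeQCDFlow.Scaling.HomStarLazyPooledFloor
import Summits.Ventures.LatticeQCDFlow.Scaling.HomStarFullCollectorFloor
import Summits.Ventures.LatticeQCDFlow.Scaling.RegenerationTagDecay

/-!
HONEST FRAMING: exact (Metropolis-corrected) sampling algorithms for lattice gauge theory; figures
of merit are autocorrelation/cost numbers at stated couplings and volumes; no continuum-physics
claim.

# HomStarLazyCeiling — THE OTHER SIDE FOR THE CONFIGURATION LAW OF THE VENTURE's HOMOGENEOUS SCHEME AT `μ_k ≡ ν`: THROUGH THE BINOMIAL CLOCK GEN-27's CEILING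
# `d′(j) ≤ (K+1)(1−a)ʲ/t′` BECOMES `d(n) ≤ ((K+1)q/t)·(1 − qa)ⁿ` BY THE BINOMIAL GENERATING FUNCTION (`Σ_j C(n,j)qʲ(1−q)ⁿ⁻ʲρʲ = (1 − q(1−ρ))ⁿ`), SO
# `t_mix(ε) ≤ ⌈(2mq/(thc))·log((K+1)q/(tε))⌉` — WITH FILE 18, `Θ((K(t+h)/(th))·log K)` FOR THE CONFIGURATION LAW, BOTH SIDES TYPED, NO HYPOTHESIS LEFT (lean-2 GEN-45, ours)

Venture-side (OURS).  Cell `lqcd-flow` (pub-lqcd), unit `pub-lqcd-lean-2-g45`, 2026-08-31.  Chapter AE, file 20.  Total variation is convex, the law of the partially lazy chain is the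
binomial mixture of file 17, and a geometric bound `Bρʲ` averages to `B(1 − q(1−ρ))ⁿ` (`add_pow`); with GEN-27's `idealStar_worstTvDist_le` for `P′` (`t′ = t/q`,
`a = t′(1−t′)c/(2m)`, `qa = t·h·c/(2mq)`, `h = (1−t)w_0`) this is a ceiling for chapter U's configuration chain, which also discharges file 18's `¼`-closeness hypothesis.

* `tvDist_mixture_le`, `choose_weights_gen`, **`partialLazy_tvDist_le_geometric`**, `homStar_clockRate_mem`, **`homStar_lazy_worstTvDist_le`**, **`homStar_lazy_mixingTime_le`**,
  **`homStar_lazy_mixingTime_two_sided_lawFree`** (`(n₀′ − 4)/(4q) ≤ t_mix(1/4) ≤ ⌈(2mq/(thc))·log(4(K+1)q/t)⌉`, for every content law with some `ν(u) ≤ ½`);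
  and for the POOLED law against X5's `π_S` (every state is a `Λ`-image since `π_S > 0` is `Λ_*⊗ν`; a lumping never increases total variation, file 15):
  **`homStar_lazy_pooled_worstTvDist_le`**, **`homStar_lazy_pooled_mixingTime_le`**, **`homStar_lazy_pooled_two_sided_lawFree`** — the same two bounds for `t_mix^{pooled}(1/4)`,
  the law of AD12's ceiling, now with explicit constants and no coupling hypotheses.

Reading (no numerics implied): at `m = cK` both sides are `(K(t+h)/(th))·log K` up to the constants `¼·(…−1)` and `2`: the configuration law of the venture's homogeneous
replica-exchange star at constant persistence obeys the two-sided `K·log K` law in the unit `K(t+h)/(th)` for EVERY content law with two or more contents — chapter U's object,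
not an idealisation — for the configuration law and for the pooled law alike.  NOT CLAIMED: persistence.  Literature grade (cell rule): OWN assembly; no new bib keys.
-/

noncomputable section

open Finset Function
open Literature.Probability.MarkovChains

namespace Summit.Ventures.LatticeQCDFlow.Scaling

/-! ## §1 Mixtures, the generating function, geometric bounds through the clock -/

section Mixture
variable {Y : Type*} [Fintype Y] [DecidableEq Y]

omit [DecidableEq Y] in
/-- **Total variation is convex:** `‖Σ_j b_j L_j − π‖_TV ≤ Σ_j b_j‖L_j − π‖_TV` for weights `b ≥ 0` of unit mass. [folklore] -/
theorem tvDist_mixture_le (s : Finset ℕ) {b : ℕ → ℝ} (hb : ∀ j ∈ s, 0 ≤ b j) (hb1 : ∑ j ∈ s, b j = 1) (L : ℕ → Y → ℝ) (π : Y → ℝ) :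
    tvDist (fun z => ∑ j ∈ s, b j * L j z) π ≤ ∑ j ∈ s, b j * tvDist (L j) π := by
  unfold tvDist
  have hR : ∀ j, b j * (1 / 2 * ∑ z, |L j z - π z|) = 1 / 2 * ∑ z, b j * |L j z - π z| := fun j => by
    rw [mul_sum, mul_sum, mul_sum]; exact sum_congr rfl fun z _ => by ring
  simp_rw [hR]
  rw [← mul_sum, Finset.sum_comm]
  refine mul_le_mul_of_nonneg_left (sum_le_sum fun z _ => ?_) (by norm_num)
  have e : ∑ j ∈ s, b j * L j z - π z = ∑ j ∈ s, b j * (L j z - π z) := by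
    rw [show ∑ j ∈ s, b j * (L j z - π z) = ∑ j ∈ s, b j * L j z - (∑ j ∈ s, b j) * π z by
      rw [sum_mul, ← sum_sub_distrib]; exact sum_congr rfl fun j _ => by ring, hb1, one_mul]
  rw [e]
  refine (Finset.abs_sum_le_sum_abs _ _).trans (le_of_eq (sum_congr rfl fun j hj => ?_))
  rw [abs_mul, abs_of_nonneg (hb j hj)]

omit [Fintype Y] [DecidableEq Y] in
/-- **The binomial generating function:** `Σ_j C(n,j)qʲ(1−q)ⁿ⁻ʲρʲ = (1 − q(1−ρ))ⁿ`. [Mathlib `add_pow`] -/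
theorem choose_weights_gen (q ρ : ℝ) (n : ℕ) : ∑ j ∈ range (n + 1), ((n.choose j : ℝ) * q ^ j * (1 - q) ^ (n - j)) * ρ ^ j = (1 - q * (1 - ρ)) ^ n := by
  have h := (add_pow (q * ρ) (1 - q) n).symm
  rw [show q * ρ + (1 - q) = 1 - q * (1 - ρ) by ring] at h
  rw [← h]
  exact sum_congr rfl fun j _ => by rw [mul_pow]; ring

/-- **A geometric ceiling passes through the binomial clock:** if `‖δ_yPʲ − π‖_TV ≤ Bρʲ` for all `j`, then
`‖δ_y(qP + (1−q)I)ⁿ − π‖_TV ≤ B(1 − q(1−ρ))ⁿ` (`0 ≤ q ≤ 1`). [ours] -/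
theorem partialLazy_tvDist_le_geometric (P : Y → Y → ℝ) {q : ℝ} (hq0 : 0 ≤ q) (hq1 : q ≤ 1) (y : Y) {π : Y → ℝ} {B ρ : ℝ}
    (hd : ∀ j, tvDist (lawAt P (Pi.single y 1) j) π ≤ B * ρ ^ j) (n : ℕ) :
    tvDist (lawAt (fun y z => q * P y z + (1 - q) * (if z = y then 1 else 0)) (Pi.single y 1) n) π ≤ B * (1 - q * (1 - ρ)) ^ n := by
  classical
  rw [lawAt_partialLazy_choose]
  have hw : ∀ j ∈ range (n + 1), 0 ≤ ((n.choose j : ℝ) * q ^ j * (1 - q) ^ (n - j)) := fun j _ => by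
    have : 0 ≤ 1 - q := by linarith
    positivity
  refine (tvDist_mixture_le (range (n + 1)) hw (choose_weights_sum q n) (fun j => lawAt P (Pi.single y 1) j) π).trans ?_
  calc ∑ j ∈ range (n + 1), ((n.choose j : ℝ) * q ^ j * (1 - q) ^ (n - j)) * tvDist (lawAt P (Pi.single y 1) j) π
      ≤ ∑ j ∈ range (n + 1), ((n.choose j : ℝ) * q ^ j * (1 - q) ^ (n - j)) * (B * ρ ^ j) := sum_le_sum fun j hj => mul_le_mul_of_nonneg_left (hd j) (hw j hj)
    _ = B * ∑ j ∈ range (n + 1), ((n.choose j : ℝ) * q ^ j * (1 - q) ^ (n - j)) * ρ ^ j := by rw [mul_sum]; exact sum_congr rfl fun j _ => by ring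
    _ = B * (1 - q * (1 - ρ)) ^ n := by rw [choose_weights_gen]

end Mixture

/-! ## §2 The ceiling for chapter U's homogeneous scheme at `μ_k ≡ ν`, and both sides -/

section HomStarCeiling
variable {S : Type*} [Fintype S] [DecidableEq S] {K m : ℕ} (κ : Fin m → Fin K) {ν : S → ℝ} {M : Fin (K + 1) → S → S → ℝ} {w : Fin (K + 1) → ℝ} {t : ℝ} {c : ℕ}

/-- The clock's rate `t·h·c/(2mq)` lies in `(0, 1]` (`h = (1−t)w_0 ≤ 1`, `q = t + h ≥ t`, `c ≤ m`). [ours] -/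
theorem homStar_clockRate_mem {t w₀ : ℝ} {c m : ℕ} (ht0 : 0 < t) (ht1 : t < 1) (hw0 : 0 < w₀) (hw1 : w₀ ≤ 1) (hc : 1 ≤ c) (hcm : c ≤ m) :
    0 < t * ((1 - t) * w₀) * c / (2 * m * (t + (1 - t) * w₀)) ∧ t * ((1 - t) * w₀) * c / (2 * m * (t + (1 - t) * w₀)) ≤ 1 := by
  have h1t : 0 < 1 - t := by linarith
  have hh : 0 < (1 - t) * w₀ := mul_pos h1t hw0
  have hh1 : (1 - t) * w₀ ≤ 1 := by nlinarith
  have hcpos : (0 : ℝ) < c := by exact_mod_cast (by omega : 0 < c)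
  have hmpos : (0 : ℝ) < m := by exact_mod_cast (by omega : 0 < m)
  have hcm' : (c : ℝ) ≤ m := by exact_mod_cast hcm
  refine ⟨by positivity, ?_⟩
  rw [div_le_one (by positivity)]
  have h1 : t * ((1 - t) * w₀) ≤ t := by nlinarith
  have h2 : t ≤ t + (1 - t) * w₀ := by linarith
  calc t * ((1 - t) * w₀) * c ≤ (t + (1 - t) * w₀) * c := by nlinarith
    _ ≤ (t + (1 - t) * w₀) * m := by nlinarith
    _ ≤ 2 * m * (t + (1 - t) * w₀) := by nlinarith

/-- **THE CEILING THROUGH THE CLOCK:** `K ≥ 1`, `0 < t < 1`, `0 < w_0`, `Σw = 1`, `w ≥ 0`, exact hot redraws, idle cold levels, listing multiplicity `≥ c ≥ 1` (`c ≤ m`), `ν > 0` of unit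
mass; `h = (1−t)w_0`, `q = t + h`: **`d(n) ≤ ((K+1)q/t)·(1 − t·h·c/(2mq))ⁿ`**. [ours] -/
theorem homStar_lazy_worstTvDist_le (hm : 1 ≤ m) (ht0 : 0 < t) (ht1 : t < 1) (hν : ∀ v, 0 < ν v) (hν1 : ∑ v, ν v = 1)
    (hM0 : ∀ u v, M 0 u v = ν v) (hidle : ∀ i : Fin K, ∀ u v, M i.succ u v = if v = u then 1 else 0)
    (hw0 : ∀ k, 0 ≤ w k) (hw00 : 0 < w 0) (hw1 : ∑ k, w k = 1) (hc1 : 1 ≤ c)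
    (hc : ∀ p : Fin K, c ≤ (univ.filter (fun r : Fin m => κ r = p)).card) (hcm : c ≤ m) (n : ℕ) :
    worstTvDist (fun y z : Fin (K + 1) → S => t * ptGraphSwap (fun _ : Fin (K + 1) => ν)
          (fun r : Fin m => (((0 : Fin (K + 1)), (κ r).succ) : Fin (K + 1) × Fin (K + 1))) (fun _ => Equiv.refl S) y z
          + (1 - t) * prodKernel w M y z) (tensorFun (fun _ : Fin (K + 1) => ν)) n
      ≤ ((K : ℝ) + 1) * (t + (1 - t) * w 0) / t * (1 - t * ((1 - t) * w 0) * c / (2 * m * (t + (1 - t) * w 0))) ^ n := by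
  classical
  have h1t : 0 < 1 - t := by linarith
  have hh : 0 < (1 - t) * w 0 := mul_pos h1t hw00
  set q : ℝ := t + (1 - t) * w 0 with hqdef
  have hq0 : 0 < q := by rw [hqdef]; linarith
  have hw0le : w 0 ≤ 1 := by
    have := Finset.single_le_sum (fun k _ => hw0 k) (mem_univ (0 : Fin (K + 1))); rw [hw1] at this; exact this
  have hq1 : q ≤ 1 := by rw [hqdef]; nlinarith
  set t' : ℝ := t / q with ht'def
  have ht'0 : 0 < t' := div_pos ht0 hq0
  have ht'1 : t' < 1 := by rw [ht'def, div_lt_one hq0, hqdef]; linarith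
  have h1t' : 1 - t' = (1 - t) * w 0 / q := by rw [ht'def]; field_simp; rw [hqdef]; ring
  have hMrs : ∀ k, IsRowStochastic (M k) := by
    intro k
    refine Fin.cases ?_ (fun i => ?_) k
    · exact ⟨fun a b => by rw [hM0]; exact (hν b).le, fun a => by simp_rw [hM0]; exact hν1⟩
    · refine ⟨fun a b => by rw [hidle]; split_ifs <;> norm_num, fun a => ?_⟩
      simp_rw [hidle]; rw [Finset.sum_ite_eq' univ a]; simp
  have hceil := fun j => idealStar_worstTvDist_le κ hm ht'0 ht'1 hν hν1 hMrs hM0 hc1 hc hcm j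
  -- the rate: `q · t′(1−t′)c/(2m) = t·h·c/(2mq)`
  have hmpos : (0 : ℝ) < m := by exact_mod_cast (by omega : 0 < m)
  have hcpos : (0 : ℝ) < c := by exact_mod_cast (by omega : 0 < c)
  have h1t'' : 0 < 1 - t' := by linarith
  have ha0 : 0 ≤ t' * (1 - t') * c / (2 * m) := by positivity
  have ha1 : t' * (1 - t') * c / (2 * m) ≤ 1 := by
    rw [div_le_one (by positivity)]
    have hcm' : (c : ℝ) ≤ m := by exact_mod_cast hcm
    have h1 : t' * (1 - t') ≤ 1 / 4 := by nlinarith [sq_nonneg (t' - 1 / 2)]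
    calc t' * (1 - t') * c ≤ 1 / 4 * c := by nlinarith
      _ ≤ 2 * m := by linarith
  have hrate : q * (1 - (1 - t' * (1 - t') * c / (2 * m))) = t * ((1 - t) * w 0) * c / (2 * m * q) := by
    rw [h1t', ht'def]; field_simp; ring
  have hB : ((K : ℝ) + 1) / t' = ((K : ℝ) + 1) * q / t := by rw [ht'def]; field_simp
  -- every start
  have hker := homStar_eq_partialLazy κ (ν := ν) (t := t) (M := M) hidle hw1 hq0.ne'
  rw [← hqdef, ← ht'def] at hker
  rw [hker]
  haveI : Nonempty S := by
    by_contra h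
    rw [not_nonempty_iff] at h
    have : ∑ v, ν v = 0 := Finset.sum_eq_zero fun v _ => (IsEmpty.false v).elim
    linarith
  refine Real.iSup_le (fun y => ?_) (mul_nonneg (by positivity) (pow_nonneg (by rw [← hrate]; nlinarith [mul_nonneg hq0.le ha0]) n))
  have hd : ∀ j, tvDist (lawAt (fun y z : Fin (K + 1) → S => t' * ptGraphSwap (fun _ : Fin (K + 1) => ν)
          (fun r : Fin m => (((0 : Fin (K + 1)), (κ r).succ) : Fin (K + 1) × Fin (K + 1))) (fun _ => Equiv.refl S) y z
          + (1 - t') * prodKernel (fun k : Fin (K + 1) => if k = 0 then (1 : ℝ) else 0) M y z) (Pi.single y 1) j) (tensorFun (fun _ : Fin (K + 1) => ν))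
        ≤ ((K : ℝ) + 1) / t' * (1 - t' * (1 - t') * c / (2 * m)) ^ j := by
    intro j
    refine (tvDist_single_le_worstTvDist _ _ j y).trans ((hceil j).trans (le_of_eq ?_))
    ring
  have h := partialLazy_tvDist_le_geometric _ hq0.le hq1 y hd n
  rw [hrate, hB] at h
  exact h

/-- **THE MIXING-TIME CEILING:** **`t_mix(ε) ≤ ⌈(2mq/(t·h·c))·log((K+1)q/(tε))⌉`**, `h = (1−t)w_0`, `q = t + h`. [ours] -/
theorem homStar_lazy_mixingTime_le (hm : 1 ≤ m) (ht0 : 0 < t) (ht1 : t < 1) (hν : ∀ v, 0 < ν v) (hν1 : ∑ v, ν v = 1)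
    (hM0 : ∀ u v, M 0 u v = ν v) (hidle : ∀ i : Fin K, ∀ u v, M i.succ u v = if v = u then 1 else 0)
    (hw0 : ∀ k, 0 ≤ w k) (hw00 : 0 < w 0) (hw1 : ∑ k, w k = 1) (hc1 : 1 ≤ c)
    (hc : ∀ p : Fin K, c ≤ (univ.filter (fun r : Fin m => κ r = p)).card) (hcm : c ≤ m) {ε : ℝ} (hε : 0 < ε) :
    mixingTime (fun y z : Fin (K + 1) → S => t * ptGraphSwap (fun _ : Fin (K + 1) => ν)
          (fun r : Fin m => (((0 : Fin (K + 1)), (κ r).succ) : Fin (K + 1) × Fin (K + 1))) (fun _ => Equiv.refl S) y z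
          + (1 - t) * prodKernel w M y z) (tensorFun (fun _ : Fin (K + 1) => ν)) ε
      ≤ ⌈2 * (m : ℝ) * (t + (1 - t) * w 0) / (t * ((1 - t) * w 0) * c) * Real.log (((K : ℝ) + 1) * (t + (1 - t) * w 0) / (t * ε))⌉₊ := by
  have h1t : 0 < 1 - t := by linarith
  have hh : 0 < (1 - t) * w 0 := mul_pos h1t hw00
  have hq0 : 0 < t + (1 - t) * w 0 := by linarith
  have hmpos : (0 : ℝ) < m := by exact_mod_cast (by omega : 0 < m)
  have hcpos : (0 : ℝ) < c := by exact_mod_cast (by omega : 0 < c)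
  have hKpos : (0 : ℝ) < (K : ℝ) + 1 := by positivity
  refine mixingTime_le _ _ ((homStar_lazy_worstTvDist_le κ hm ht0 ht1 hν hν1 hM0 hidle hw0 hw00 hw1 hc1 hc hcm _).trans ?_)
  have hw0le : w 0 ≤ 1 := by
    have := Finset.single_le_sum (fun k _ => hw0 k) (mem_univ (0 : Fin (K + 1))); rw [hw1] at this; exact this
  obtain ⟨ha0, ha1⟩ := homStar_clockRate_mem (m := m) ht0 ht1 hw00 hw0le hc1 hcm
  refine geom_le_of_ge_log ha0 ha1 (by positivity) hε (le_trans (le_of_eq ?_) (Nat.le_ceil _))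
  rw [show ((K : ℝ) + 1) * (t + (1 - t) * w 0) / t / ε = ((K : ℝ) + 1) * (t + (1 - t) * w 0) / (t * ε) by rw [div_div]]
  congr 1
  field_simp

/-- **THE TWO-SIDED `K·log K` LAW FOR THE CONFIGURATION LAW OF THE VENTURE's HOMOGENEOUS SCHEME AT CONSTANT PERSISTENCE, EVERY CONTENT LAW:** `K ≥ 2`, uniform listing
(`m = cK`, `c ≥ 1`), `0 < t < 1`, `0 < w_0`, exact hot redraws, idle cold levels, any `ν > 0` with some `ν(u) ≤ ½`; `h = (1−t)w_0`, `q = t + h`: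
**`((Kq²/(th) − 1)·log((K + t/q)/max{260, 8√(2(K+1))}) − 4)/(4q) ≤ t_mix(1/4) ≤ ⌈(2mq/(thc))·log(4(K+1)q/t)⌉`** — no hypothesis on the chain left. [ours] -/
theorem homStar_lazy_mixingTime_two_sided_lawFree (hm : 1 ≤ m) (ht0 : 0 < t) (ht1 : t < 1) (hK : 2 ≤ K) (hν : ∀ v, 0 < ν v) (hν1 : ∑ v, ν v = 1)
    (hM0 : ∀ u v, M 0 u v = ν v) (hidle : ∀ i : Fin K, ∀ u v, M i.succ u v = if v = u then 1 else 0)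
    (hw0 : ∀ k, 0 ≤ w k) (hw00 : 0 < w 0) (hw1 : ∑ k, w k = 1)
    (hunif : ∀ i : Fin K, (univ.filter fun r : Fin m => κ r = i).card = c) (hmc : m = c * K) (u : S) (hu : ν u ≤ 1 / 2) :
    ((((K : ℝ) * (t + (1 - t) * w 0) ^ 2 / (t * ((1 - t) * w 0)) - 1)
        * Real.log (((K : ℝ) + t / (t + (1 - t) * w 0)) / max 260 (8 * Real.sqrt (2 * ((K : ℝ) + 1))))) - 4) / (4 * (t + (1 - t) * w 0))
      ≤ (mixingTime (fun y z : Fin (K + 1) → S => t * ptGraphSwap (fun _ : Fin (K + 1) => ν)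
          (fun r : Fin m => (((0 : Fin (K + 1)), (κ r).succ) : Fin (K + 1) × Fin (K + 1))) (fun _ => Equiv.refl S) y z
          + (1 - t) * prodKernel w M y z) (tensorFun (fun _ : Fin (K + 1) => ν)) (1 / 4) : ℝ) ∧
    mixingTime (fun y z : Fin (K + 1) → S => t * ptGraphSwap (fun _ : Fin (K + 1) => ν)
          (fun r : Fin m => (((0 : Fin (K + 1)), (κ r).succ) : Fin (K + 1) × Fin (K + 1))) (fun _ => Equiv.refl S) y z
          + (1 - t) * prodKernel w M y z) (tensorFun (fun _ : Fin (K + 1) => ν)) (1 / 4)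
      ≤ ⌈2 * (m : ℝ) * (t + (1 - t) * w 0) / (t * ((1 - t) * w 0) * c) * Real.log (((K : ℝ) + 1) * (t + (1 - t) * w 0) / (t * (1 / 4)))⌉₊ := by
  have hc1 : 1 ≤ c := by
    rcases Nat.eq_zero_or_pos c with h | h
    · rw [h, zero_mul] at hmc; omega
    · exact h
  have hcm : c ≤ m := by rw [hmc]; exact Nat.le_mul_of_pos_right c (by omega)
  have hc : ∀ p : Fin K, c ≤ (univ.filter (fun r : Fin m => κ r = p)).card := fun p => (hunif p).ge
  refine ⟨?_, homStar_lazy_mixingTime_le κ hm ht0 ht1 hν hν1 hM0 hidle hw0 hw00 hw1 hc1 hc hcm (by norm_num)⟩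
  have hmix := homStar_lazy_worstTvDist_le κ hm ht0 ht1 hν hν1 hM0 hidle hw0 hw00 hw1 hc1 hc hcm
  -- `¼`-closeness at the ceiling's time
  have h1t : 0 < 1 - t := by linarith
  have hh : 0 < (1 - t) * w 0 := mul_pos h1t hw00
  have hq0 : 0 < t + (1 - t) * w 0 := by linarith
  have hmpos : (0 : ℝ) < m := by exact_mod_cast (by omega : 0 < m)
  have hcpos : (0 : ℝ) < c := by exact_mod_cast (by omega : 0 < c)
  have hw0le : w 0 ≤ 1 := by
    have := Finset.single_le_sum (fun k _ => hw0 k) (mem_univ (0 : Fin (K + 1))); rw [hw1] at this; exact this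
  obtain ⟨ha0, ha1⟩ := homStar_clockRate_mem (m := m) ht0 ht1 hw00 hw0le hc1 hcm
  set n₁ : ℕ := ⌈1 / (t * ((1 - t) * w 0) * c / (2 * m * (t + (1 - t) * w 0))) * Real.log (((K : ℝ) + 1) * (t + (1 - t) * w 0) / t / (1 / 4))⌉₊ with hn₁
  have hclose : worstTvDist (fun y z : Fin (K + 1) → S => t * ptGraphSwap (fun _ : Fin (K + 1) => ν)
          (fun r : Fin m => (((0 : Fin (K + 1)), (κ r).succ) : Fin (K + 1) × Fin (K + 1))) (fun _ => Equiv.refl S) y z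
          + (1 - t) * prodKernel w M y z) (tensorFun (fun _ : Fin (K + 1) => ν)) n₁ ≤ 1 / 4 :=
    (hmix n₁).trans (geom_le_of_ge_log ha0 ha1 (by positivity) (by norm_num) (Nat.le_ceil _))
  exact homStar_lazy_mixingTime_ge_lawFree κ hm ht0 ht1 hK hν hν1 hM0 hidle hw0 hw00 hw1 hunif hmc u hu ⟨n₁, hclose⟩

end HomStarCeiling

/-! ## §3 The pooled law: both sides against X5's `π_S` -/

section PooledCeiling
variable {S : Type*} [Fintype S] [DecidableEq S] {K m : ℕ} (κ : Fin m → Fin K) {ν : S → ℝ} {M : Fin (K + 1) → S → S → ℝ} {w : Fin (K + 1) → ℝ} {t : ℝ} {c : ℕ}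
variable {X : Type*} [Fintype X] [DecidableEq X] {hub : X → S} {comp : X → S → ℕ} {W : S → ℝ} {acc : S → S → ℝ} {Kh : (S → ℕ) → S → S → ℝ}
variable {Ast Bst Sl : X → X → ℝ} {g : (S → ℕ) → ℝ} {πS : X → ℝ} {Z : ℝ}
variable {Λ : (Fin (K + 1) → S) → X}

/-- **THE POOLED CEILING:** under X5's closed form for `π_S`, at `μ_k ≡ ν`, **`d^{pooled}(n) ≤ ((K+1)q/t)·(1 − t·h·c/(2mq))ⁿ`** — every state is `Λy` for some `y` (its `π_S`-mass is a
positive fibre sum), `δ_{Λy}S_lⁿ = Λ_*(δ_yPⁿ)` (AD9), `π_S = Λ_*⊗ν` (AD15), and a lumping never increases total variation (file 15). [ours] -/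
theorem homStar_lazy_pooled_worstTvDist_le [Nonempty X] (hm : 1 ≤ m) (ht0 : 0 < t) (ht1 : t < 1) (hν : ∀ v, 0 < ν v) (hν1 : ∑ v, ν v = 1)
    (hM0 : ∀ u v, M 0 u v = ν v) (hidle : ∀ i : Fin K, ∀ u v, M i.succ u v = if v = u then 1 else 0)
    (hw0 : ∀ k, 0 ≤ w k) (hw00 : 0 < w 0) (hw1 : ∑ k, w k = 1) (hc1 : 1 ≤ c)
    (hunif : ∀ i : Fin K, (univ.filter fun r : Fin m => κ r = i).card = c) (hcm : c ≤ m)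
    (hWone : ∀ v, W v = 1) (hacc : ∀ h v, acc h v = min 1 (W h / W v)) (hinj : ∀ x x', hub x = hub x' → comp x = comp x' → x = x')
    (hsum : ∀ x, ∑ v, comp x v = K + 1) (hsurj : ∀ (z : S) (N : S → ℕ), ∑ v, N v = K + 1 → N z ≠ 0 → ∃ x, hub x = z ∧ comp x = N) (hhub : ∀ x, comp x (hub x) ≠ 0)
    (hKoff : ∀ N h v, h ≠ v → Kh N h v = if N h = 0 then 0 else (N v : ℝ) / K * acc h v) (hKdiag : ∀ N h, Kh N h h = 1 - ∑ v ∈ univ.erase h, Kh N h v)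
    (hA : ∀ x x', Ast x x' = if comp x' = comp x then Kh (comp x) (hub x) (hub x') else 0)
    (hB : ∀ x x', Bst x x' = ν (hub x') * (if comp x' + Pi.single (hub x) 1 = comp x + Pi.single (hub x') 1 then 1 else 0))
    (hSl : ∀ x x', Sl x x' = t * Ast x x' + (1 - t) * (w 0 * Bst x x' + (1 - w 0) * (if x = x' then 1 else 0)))
    (hg : ∀ N, g N = ∏ v, (ν v * W v) ^ (N v) / ((N v).factorial : ℝ))
    (hZ : Z = ∑ x, g (comp x) * ((comp x (hub x) : ℝ) / W (hub x))) (hπS : ∀ x, πS x = g (comp x) * ((comp x (hub x) : ℝ) / W (hub x)) / Z)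
    (hΛh : ∀ y, hub (Λ y) = y 0) (hΛc : ∀ y v, comp (Λ y) v = (univ.filter fun k : Fin (K + 1) => y k = v).card) (n : ℕ) :
    worstTvDist Sl πS n ≤ ((K : ℝ) + 1) * (t + (1 - t) * w 0) / t * (1 - t * ((1 - t) * w 0) * c / (2 * m * (t + (1 - t) * w 0))) ^ n := by
  classical
  have hK1 : 1 ≤ K := by have := (κ ⟨0, by omega⟩).isLt; omega
  have hμ : ∀ (k : Fin (K + 1)) (x : S), 0 < (fun _ : Fin (K + 1) => ν) k x := fun _ x => hν x
  have hWdef : ∀ v, W v = (fun _ : Fin (K + 1) => ν) 1 v / (fun _ : Fin (K + 1) => ν) 0 v := fun v => by rw [hWone]; simp only; rw [div_self (hν v).ne']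
  have hB' : ∀ x x', Bst x x' = (fun _ : Fin (K + 1) => ν) 0 (hub x') * (if comp x' + Pi.single (hub x) 1 = comp x + Pi.single (hub x') 1 then 1 else 0) :=
    fun x x' => by rw [hB]
  have hg' : ∀ N, g N = ∏ v, ((fun _ : Fin (K + 1) => ν) 0 v * W v) ^ (N v) / ((N v).factorial : ℝ) := fun N => by rw [hg]
  have hacc' : ∀ a b, acc a b = min 1 ((fun _ : Fin (K + 1) => ν) 0 b * (fun _ : Fin (K + 1) => ν) 1 a / ((fun _ : Fin (K + 1) => ν) 0 a * (fun _ : Fin (K + 1) => ν) 1 b)) := by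
    intro a b; rw [hacc, hWone, hWone]; simp only
    rw [div_one, show ν b * ν a / (ν a * ν b) = 1 from by rw [mul_comm]; exact div_self (mul_ne_zero (hν a).ne' (hν b).ne')]
  have hπ : ∀ x, πS x = ∑ y ∈ univ.filter (fun y => Λ y = x), tensorFun (fun _ : Fin (K + 1) => ν) y := fun x =>
    homStar_piS_eq_pushforward κ (μ := fun _ : Fin (K + 1) => ν) hm hμ (fun _ => hν1) (fun _ => rfl) hw0 hw00 hw1 ht0 ht1 hM0 hidle hunif hWdef hinj hsum hsurj hhub
      hK1 hacc hKoff hKdiag hA hB' hSl hg' hZ hπS hΛh hΛc x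
  have hπfun : πS = fun x => ∑ y ∈ univ.filter (fun y => Λ y = x), tensorFun (fun _ : Fin (K + 1) => ν) y := funext hπ
  have hW' : ∀ v, 0 < W v := fun v => by rw [hWone]; norm_num
  have hπpos := lumpedStar_piS_pos hhub hW' hν hg hZ hπS
  -- every state is a `Λ`-image
  have hsurjΛ : ∀ x, ∃ y, Λ y = x := by
    intro x
    by_contra hx
    push Not at hx
    have h0 : πS x = 0 := by
      rw [hπ x]; exact Finset.sum_eq_zero fun y hy => (hx y (mem_filter.mp hy).2).elim
    exact (lt_irrefl (0 : ℝ)) (h0 ▸ hπpos x)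
  have hc : ∀ p : Fin K, c ≤ (univ.filter (fun r : Fin m => κ r = p)).card := fun p => (hunif p).ge
  have hceil := homStar_lazy_worstTvDist_le κ hm ht0 ht1 hν hν1 hM0 hidle hw0 hw00 hw1 hc1 hc hcm n
  have hnonneg : 0 ≤ ((K : ℝ) + 1) * (t + (1 - t) * w 0) / t * (1 - t * ((1 - t) * w 0) * c / (2 * m * (t + (1 - t) * w 0))) ^ n := by
    have hw0le : w 0 ≤ 1 := by
      have := Finset.single_le_sum (fun k _ => hw0 k) (mem_univ (0 : Fin (K + 1))); rw [hw1] at this; exact this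
    obtain ⟨ha0, ha1⟩ := homStar_clockRate_mem (m := m) ht0 ht1 hw00 hw0le hc1 hcm
    have : 0 ≤ t + (1 - t) * w 0 := by nlinarith [hw0 0]
    exact mul_nonneg (by positivity) (pow_nonneg (by linarith) n)
  refine Real.iSup_le (fun x => ?_) hnonneg
  obtain ⟨y, hy⟩ := hsurjΛ x
  have hpush := homStar_pushforward_lawAt κ (μ := fun _ : Fin (K + 1) => ν) hm hμ (fun _ => rfl) hw1 hM0 hidle hunif hacc' hKoff hKdiag hA hB' hSl hΛh hΛc hinj
    (Pi.single y 1) n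
  have hδ : (fun x' => ∑ y' ∈ univ.filter (fun y' => Λ y' = x'), (Pi.single y (1 : ℝ) : (Fin (K + 1) → S) → ℝ) y') = Pi.single x 1 := by
    rw [← hy]; exact funext fun x' => lumping_pushforward_single y x'
  rw [hδ] at hpush
  rw [← hpush, hπfun]
  refine (tvDist_pushforward_le Λ _ _).trans ((tvDist_single_le_worstTvDist _ _ n y).trans hceil)

/-- **THE POOLED MIXING-TIME CEILING:** **`t_mix^{pooled}(ε) ≤ ⌈(2mq/(t·h·c))·log((K+1)q/(tε))⌉`** under X5's closed form for `π_S`, at `μ_k ≡ ν`. [ours] -/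
theorem homStar_lazy_pooled_mixingTime_le [Nonempty X] (hm : 1 ≤ m) (ht0 : 0 < t) (ht1 : t < 1) (hν : ∀ v, 0 < ν v) (hν1 : ∑ v, ν v = 1)
    (hM0 : ∀ u v, M 0 u v = ν v) (hidle : ∀ i : Fin K, ∀ u v, M i.succ u v = if v = u then 1 else 0)
    (hw0 : ∀ k, 0 ≤ w k) (hw00 : 0 < w 0) (hw1 : ∑ k, w k = 1) (hc1 : 1 ≤ c)
    (hunif : ∀ i : Fin K, (univ.filter fun r : Fin m => κ r = i).card = c) (hcm : c ≤ m)
    (hWone : ∀ v, W v = 1) (hacc : ∀ h v, acc h v = min 1 (W h / W v)) (hinj : ∀ x x', hub x = hub x' → comp x = comp x' → x = x')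
    (hsum : ∀ x, ∑ v, comp x v = K + 1) (hsurj : ∀ (z : S) (N : S → ℕ), ∑ v, N v = K + 1 → N z ≠ 0 → ∃ x, hub x = z ∧ comp x = N) (hhub : ∀ x, comp x (hub x) ≠ 0)
    (hKoff : ∀ N h v, h ≠ v → Kh N h v = if N h = 0 then 0 else (N v : ℝ) / K * acc h v) (hKdiag : ∀ N h, Kh N h h = 1 - ∑ v ∈ univ.erase h, Kh N h v)
    (hA : ∀ x x', Ast x x' = if comp x' = comp x then Kh (comp x) (hub x) (hub x') else 0)
    (hB : ∀ x x', Bst x x' = ν (hub x') * (if comp x' + Pi.single (hub x) 1 = comp x + Pi.single (hub x') 1 then 1 else 0))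
    (hSl : ∀ x x', Sl x x' = t * Ast x x' + (1 - t) * (w 0 * Bst x x' + (1 - w 0) * (if x = x' then 1 else 0)))
    (hg : ∀ N, g N = ∏ v, (ν v * W v) ^ (N v) / ((N v).factorial : ℝ))
    (hZ : Z = ∑ x, g (comp x) * ((comp x (hub x) : ℝ) / W (hub x))) (hπS : ∀ x, πS x = g (comp x) * ((comp x (hub x) : ℝ) / W (hub x)) / Z)
    (hΛh : ∀ y, hub (Λ y) = y 0) (hΛc : ∀ y v, comp (Λ y) v = (univ.filter fun k : Fin (K + 1) => y k = v).card) {ε : ℝ} (hε : 0 < ε) :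
    mixingTime Sl πS ε ≤ ⌈2 * (m : ℝ) * (t + (1 - t) * w 0) / (t * ((1 - t) * w 0) * c) * Real.log (((K : ℝ) + 1) * (t + (1 - t) * w 0) / (t * ε))⌉₊ := by
  have h1t : 0 < 1 - t := by linarith
  have hh : 0 < (1 - t) * w 0 := mul_pos h1t hw00
  have hq0 : 0 < t + (1 - t) * w 0 := by linarith
  have hmpos : (0 : ℝ) < m := by exact_mod_cast (by omega : 0 < m)
  have hcpos : (0 : ℝ) < c := by exact_mod_cast (by omega : 0 < c)
  have hKpos : (0 : ℝ) < (K : ℝ) + 1 := by positivity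
  refine mixingTime_le _ _ ((homStar_lazy_pooled_worstTvDist_le κ hm ht0 ht1 hν hν1 hM0 hidle hw0 hw00 hw1 hc1 hunif hcm hWone hacc hinj hsum hsurj hhub hKoff hKdiag hA hB hSl
    hg hZ hπS hΛh hΛc _).trans ?_)
  have hw0le : w 0 ≤ 1 := by
    have := Finset.single_le_sum (fun k _ => hw0 k) (mem_univ (0 : Fin (K + 1))); rw [hw1] at this; exact this
  obtain ⟨ha0, ha1⟩ := homStar_clockRate_mem (m := m) ht0 ht1 hw00 hw0le hc1 hcm
  refine geom_le_of_ge_log ha0 ha1 (by positivity) hε (le_trans (le_of_eq ?_) (Nat.le_ceil _))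
  rw [show ((K : ℝ) + 1) * (t + (1 - t) * w 0) / t / ε = ((K : ℝ) + 1) * (t + (1 - t) * w 0) / (t * ε) by rw [div_div]]
  congr 1
  field_simp

/-- **THE TWO-SIDED `K·log K` LAW FOR THE POOLED LAW — THE LAW OF AD12's CEILING — AT CONSTANT PERSISTENCE, EVERY CONTENT LAW, UNCONDITIONALLY IN THE CHAIN:** uniform listing
(`m = cK`), `K ≥ 2`, `0 < t < 1`, `0 < w_0`, `ν > 0` with some `ν(u) ≤ ½`, X5's closed form for `π_S`:
**`((Kq²/(th) − 1)·log((K + t/q)/max{260, 8√(2(K+1))}) − 4)/(4q) ≤ t_mix^{pooled}(1/4) ≤ ⌈(2mq/(thc))·log(4(K+1)q/t)⌉`**. [ours] -/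
theorem homStar_lazy_pooled_two_sided_lawFree [Nonempty X] (hm : 1 ≤ m) (ht0 : 0 < t) (ht1 : t < 1) (hK : 2 ≤ K) (hν : ∀ v, 0 < ν v) (hν1 : ∑ v, ν v = 1)
    (hM0 : ∀ u v, M 0 u v = ν v) (hidle : ∀ i : Fin K, ∀ u v, M i.succ u v = if v = u then 1 else 0)
    (hw0 : ∀ k, 0 ≤ w k) (hw00 : 0 < w 0) (hw1 : ∑ k, w k = 1)
    (hunif : ∀ i : Fin K, (univ.filter fun r : Fin m => κ r = i).card = c) (hmc : m = c * K)
    (hWone : ∀ v, W v = 1) (hacc : ∀ h v, acc h v = min 1 (W h / W v)) (hinj : ∀ x x', hub x = hub x' → comp x = comp x' → x = x')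
    (hsum : ∀ x, ∑ v, comp x v = K + 1) (hsurj : ∀ (z : S) (N : S → ℕ), ∑ v, N v = K + 1 → N z ≠ 0 → ∃ x, hub x = z ∧ comp x = N) (hhub : ∀ x, comp x (hub x) ≠ 0)
    (hKoff : ∀ N h v, h ≠ v → Kh N h v = if N h = 0 then 0 else (N v : ℝ) / K * acc h v) (hKdiag : ∀ N h, Kh N h h = 1 - ∑ v ∈ univ.erase h, Kh N h v)
    (hA : ∀ x x', Ast x x' = if comp x' = comp x then Kh (comp x) (hub x) (hub x') else 0)
    (hB : ∀ x x', Bst x x' = ν (hub x') * (if comp x' + Pi.single (hub x) 1 = comp x + Pi.single (hub x') 1 then 1 else 0))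
    (hSl : ∀ x x', Sl x x' = t * Ast x x' + (1 - t) * (w 0 * Bst x x' + (1 - w 0) * (if x = x' then 1 else 0)))
    (hg : ∀ N, g N = ∏ v, (ν v * W v) ^ (N v) / ((N v).factorial : ℝ))
    (hZ : Z = ∑ x, g (comp x) * ((comp x (hub x) : ℝ) / W (hub x))) (hπS : ∀ x, πS x = g (comp x) * ((comp x (hub x) : ℝ) / W (hub x)) / Z)
    (hΛh : ∀ y, hub (Λ y) = y 0) (hΛc : ∀ y v, comp (Λ y) v = (univ.filter fun k : Fin (K + 1) => y k = v).card) (u : S) (hu : ν u ≤ 1 / 2) :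
    ((((K : ℝ) * (t + (1 - t) * w 0) ^ 2 / (t * ((1 - t) * w 0)) - 1)
        * Real.log (((K : ℝ) + t / (t + (1 - t) * w 0)) / max 260 (8 * Real.sqrt (2 * ((K : ℝ) + 1))))) - 4) / (4 * (t + (1 - t) * w 0))
      ≤ (mixingTime Sl πS (1 / 4) : ℝ) ∧
    mixingTime Sl πS (1 / 4) ≤ ⌈2 * (m : ℝ) * (t + (1 - t) * w 0) / (t * ((1 - t) * w 0) * c) * Real.log (((K : ℝ) + 1) * (t + (1 - t) * w 0) / (t * (1 / 4)))⌉₊ := by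
  have hc1 : 1 ≤ c := by
    rcases Nat.eq_zero_or_pos c with h | h
    · rw [h, zero_mul] at hmc; omega
    · exact h
  have hcm : c ≤ m := by rw [hmc]; exact Nat.le_mul_of_pos_right c (by omega)
  exact ⟨homStar_lazy_pooled_mixingTime_ge_lawFree κ hm ht0 ht1 hK hν hν1 hM0 hidle hw0 hw00 hw1 hunif hmc hWone hacc hinj hsum hsurj hhub hKoff hKdiag hA hB hSl hg hZ hπS
      hΛh hΛc u hu,
    homStar_lazy_pooled_mixingTime_le κ hm ht0 ht1 hν hν1 hM0 hidle hw0 hw00 hw1 hc1 hunif hcm hWone hacc hinj hsum hsurj hhub hKoff hKdiag hA hB hSl hg hZ hπS hΛh hΛc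
      (by norm_num)⟩

end PooledCeiling

end Summit.Ventures.LatticeQCDFlow.Scaling

end
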